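import Literature.Topology.FourManifolds.SurfaceGroupGoeritzMoves
import Literature.Topology.FourManifolds.SurfaceGroupCutKernelMovesZ
import Literature.Topology.FourManifolds.SurfaceGroupOrientationFlip
import Literature.Topology.FourManifolds.SymplecticPairStabilizerGeneration
import Literature.Topology.FourManifolds.SymplecticPairStabilizerUnipotent
import Literature.Algebra.Lie.SurfaceLieAlgebra
import Summits.SmoothPoincare4.SmoothPoincare4.Theorems.CongruenceShadowsNilpotentShadowsStandardStubCutNormalForm
import HarnessLib

/-!
# Stub `stub_goeritzRealisationPos` of line `nilpotent-genus-class` for crux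
`CongruenceShadows.ShadowApproximation` (item stmt-SmoothPoincare4-14595, route
route-SmoothPoincare4-CongruenceShadows) — GS₀ at genus `3 + 3m`

Proves the registered stub **`stub_goeritzRealisationPos`** verbatim: for every `m ≥ 1` (in fact
for every `m`, and without using the genus-`3` hypothesis), every `±`-isometry `F` of
`H₁ = ℤ^{2(3+3m)}` stabilising the two coordinate Lagrangians
`Λᵢ = span {δ_y : y ∈ s4CutSystem m i}` (`i = 0, 1`) of the standard `(3+3m; m+1)` trisection of
`S⁴` is induced by an automorphism `x` of `S = SurfaceGroup (3+3m)` stabilising both kernels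
`N 0 = s4Kernels.stabilizeIter m 0`, `N 1` (an element of the GOERITZ GROUP `A ∩ B` of the
standard genus-`3(m+1)` Heegaard splitting of `#^{m+1} S¹×S²`): `ab ∘ x = F ∘ ab`.

* §1 `symplForm_swapLin`, `swapLin_apply_not`, `swapLin_apply_not_or`,
  `mem_span_range_single_iff`, and **`exists_goeritz_realises` — GS₀ for a COORDINATE PAIR of cut
  systems** `c₀, c₁ : Fin g → Bool` with disjoint `b`-letters (handle by handle `(a,a)`, `(b,a)`
  or `(a,b)`: the cut systems of the standard splitting of `#ᵏ S¹×S²`): every `ε`-isometry of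
  `(H₁, ν)` stabilising `Λ_{c₀}`, `Λ_{c₁}` is induced by an automorphism stabilising
  `cutKernel c₀`, `cutKernel c₁`.  Proof: conjugate by the cut swap of `c₀`
  (`SurfaceGroup.cutSwapEquiv`, homology action `J`) to the pair `(⟪aⱼ⟫, cutKernel (c₀ ∨ c₁))`;
  its Goeritz group contains realisers of the compatible elementary moves `moveZ`, `moveX`,
  `moveW`, the sign changes and the orientation flip (`SurfaceGroupGoeritzMoves.lean`), which
  generate the stabiliser `Stab_{Sp^{±}}(Λ_A, Λ_t)` (`mem_of_pairStabilizer_signed` of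
  `SymplecticPairStabilizerGeneration.lean`, with the unipotent step `mem_of_blocks_eq_one` of
  `SymplecticPairStabilizerUnipotent.lean`); conjugate back.
* §2 `s4CutSystem_eq_range`, `stabilizeIter_eq_cutKernel`, `span_single_s4CutSystem` — the cut
  system of slot `i` is the graph of `j ↦ (j + i ≡ 2 mod 3)` (slot `0` cuts `bⱼ` on `j ≡ 2`,
  slot `1` on `j ≡ 1 (mod 3)`, `aⱼ` elsewhere: disjoint `b`-letters), so `N i` is the cut kernel
  of that function (cut normal form `stub_cutNormalForm`) and `Λᵢ` the span of its `δ`'s;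
  `coords_of_map_span_eq` turns `Λ.map F = Λ` into coordinates.
* §3 the stub.
-/

-- the prescribed namespace `Summit.<P>.<Sub>.…` duplicates `SmoothPoincare4` (P = Sub)
set_option linter.dupNamespace false

noncomputable section

open Literature.Topology.FourManifolds Literature.Algebra.Lie Multiplicative

namespace Summit.SmoothPoincare4.SmoothPoincare4.Theorems.ShadowApproximation.NilpotentGenusClass

/-! ## §1 GS₀ for a coordinate pair of cut systems -/

section SwapLin

variable {ι : Type*} [Fintype ι]

/-- The quarter rotation `J` of the handles of `d` (`(J v)_{bᵢ} = v_{aᵢ}`, `(J v)_{aᵢ} = -v_{bᵢ}`) is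
symplectic. [folklore] -/
theorem symplForm_swapLin (d : ι → Bool) (J : (ι × Bool → ℤ) ≃ₗ[ℤ] (ι × Bool → ℤ))
    (hJ : ∀ v p, J v p = if d p.1 then (if p.2 then v (p.1, false) else -v (p.1, true)) else v p)
    (u v : ι × Bool → ℤ) : symplForm (J u) (J v) = symplForm u v := by
  rw [symplForm_apply, symplForm_apply]
  refine Finset.sum_congr rfl fun i _ => ?_
  simp only [hJ, if_true, Bool.false_eq_true, if_false]
  split_ifs <;> ring

omit [Fintype ι] in
/-- `J` exchanges the conditions `v_{bᵢ} = 0` and `v_{(i, ¬d i)} = 0`: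
`(J v)_{(i, ¬d i)} = ∓ v_{bᵢ}`. [folklore] -/
theorem swapLin_apply_not (d : ι → Bool) (J : (ι × Bool → ℤ) ≃ₗ[ℤ] (ι × Bool → ℤ))
    (hJ : ∀ v p, J v p = if d p.1 then (if p.2 then v (p.1, false) else -v (p.1, true)) else v p)
    (v : ι × Bool → ℤ) (i : ι) : J v (i, !d i) = if d i then -v (i, true) else v (i, true) := by
  rw [hJ]
  cases d i <;> simp

omit [Fintype ι] in
/-- `J` exchanges the conditions `v_{(i, ¬(d i ∨ c i))} = 0` and `v_{(i, ¬c i)} = 0` when `d`, `c`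
cut disjoint `b`-letters: `(J v)_{(i, ¬c i)} = v_{(i, ¬(d i ∨ c i))}`. [folklore] -/
theorem swapLin_apply_not_or (d c : ι → Bool) (hdc : ∀ i, d i = true → c i = false)
    (J : (ι × Bool → ℤ) ≃ₗ[ℤ] (ι × Bool → ℤ))
    (hJ : ∀ v p, J v p = if d p.1 then (if p.2 then v (p.1, false) else -v (p.1, true)) else v p)
    (v : ι × Bool → ℤ) (i : ι) : J v (i, !c i) = v (i, !(d i || c i)) := by
  rw [hJ]
  cases hd : d i
  · simp
  · simp [hdc i hd]

/-- **Coordinate Lagrangians by coordinates**: `v ∈ span {δ_{(i, c i)} : i}` iff `v_{(i, ¬c i)} = 0`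
for all `i`. [folklore] -/
theorem mem_span_range_single_iff [DecidableEq ι] (c : ι → Bool) (v : ι × Bool → ℤ) :
    v ∈ Submodule.span ℤ (Set.range fun i => (Pi.single (i, c i) (1 : ℤ) : ι × Bool → ℤ)) ↔
      ∀ i, v (i, !c i) = 0 := by
  constructor
  · intro hv
    induction hv using Submodule.span_induction with
    | mem x hx =>
      obtain ⟨j, rfl⟩ := hx
      intro i
      simp only []
      rw [Pi.single_apply, if_neg]
      intro h
      rw [Prod.mk.injEq] at h
      obtain ⟨rfl, h2⟩ := h
      cases hc : c i <;> rw [hc] at h2 <;> exact absurd h2 (by decide)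
    | zero => intro i; rfl
    | add x y _ _ hx hy => intro i; rw [Pi.add_apply, hx, hy, add_zero]
    | smul a x _ hx => intro i; rw [Pi.smul_apply, hx, smul_zero]
  · intro hv
    rw [pi_eq_sum_univ' v, Fintype.sum_prod_type]
    refine Submodule.sum_mem _ fun i _ => ?_
    rw [Fintype.sum_bool]
    have hmem : v (i, c i) • (Pi.single (i, c i) (1 : ℤ) : ι × Bool → ℤ) ∈
        Submodule.span ℤ (Set.range fun i => (Pi.single (i, c i) (1 : ℤ) : ι × Bool → ℤ)) :=
      Submodule.smul_mem _ _ (Submodule.subset_span ⟨i, rfl⟩)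
    cases hc : c i
    · have h0 : v (i, true) = 0 := by simpa [hc] using hv i
      rw [h0, zero_smul, zero_add, ← hc]
      exact hmem
    · have h0 : v (i, false) = 0 := by simpa [hc] using hv i
      rw [h0, zero_smul, add_zero, ← hc]
      exact hmem

end SwapLin

section Realisation

variable {g : ℕ}

/-- **GS₀ for coordinate pairs of cut systems.**  Let `c₀, c₁` be cut systems of `S_g` with
disjoint `b`-letters (`c₀ i = true → c₁ i = false`).  Every `ε`-isometry `F` (`ε = ±1`) of
`(H₁ = ℤ^{2g}, ν)` with `F Λ_{c₀} ⊆ Λ_{c₀}` and `F Λ_{c₁} ⊆ Λ_{c₁}` (coordinate conditions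
`v_{(i, ¬c i)} = 0`) is induced by an automorphism `x` of `S_g` stabilising both cut kernels:
`x(SurfaceGroup.cutKernel c₀) = SurfaceGroup.cutKernel c₀`, `x(SurfaceGroup.cutKernel c₁) = SurfaceGroup.cutKernel c₁`, `ab ∘ x = F ∘ ab`.
Proof: conjugate by the cut swap of `c₀` to the pair `(⟪aᵢ⟫, SurfaceGroup.cutKernel (c₀ ∨ c₁))`, whose
Goeritz group contains the compatible moves (`SurfaceGroupGoeritzMoves.lean`) which generate the
stabiliser (`mem_of_pairStabilizer_signed`). [cite: ZieschangVogtColdewey1980, 3.6.7 and 3.6.10–3.6.12] -/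
theorem exists_goeritz_realises (c₀ c₁ : Fin g → Bool) (h01 : ∀ i, c₀ i = true → c₁ i = false)
    (F : (surfaceGen g → ℤ) ≃ₗ[ℤ] (surfaceGen g → ℤ)) (ε : ℤ) (hε : ε = 1 ∨ ε = -1)
    (hS : ∀ u v, symplForm (F u) (F v) = ε * symplForm u v)
    (h0 : ∀ v : surfaceGen g → ℤ, (∀ i, v (i, !c₀ i) = 0) → ∀ i, F v (i, !c₀ i) = 0)
    (h1 : ∀ v : surfaceGen g → ℤ, (∀ i, v (i, !c₁ i) = 0) → ∀ i, F v (i, !c₁ i) = 0) :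
    ∃ x : SurfaceGroup g ≃* SurfaceGroup g,
      (SurfaceGroup.cutKernel c₀).map x.toMonoidHom = SurfaceGroup.cutKernel c₀ ∧
      (SurfaceGroup.cutKernel c₁).map x.toMonoidHom = SurfaceGroup.cutKernel c₁ ∧
      ∀ s, toAdd (SurfaceGroup.abelianize g (x s)) = F (toAdd (SurfaceGroup.abelianize g s)) := by
  classical
  -- the conjugated pair of cuts `(⊥, t)`, `t = c₀ ∨ c₁`, and the image of its Goeritz group
  set t : Fin g → Bool := fun i => c₀ i || c₁ i with ht
  set 𝒞 : Set (Fin g → Bool) := {fun _ => false, t} with h𝒞def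
  obtain ⟨R, hR⟩ := SurfaceGroup.exists_goeritzSubgroup 𝒞
  have h𝒞 : ∀ c ∈ 𝒞, c = (fun _ => false) ∨ c = t := fun c hc => by
    simpa [h𝒞def, Set.mem_insert_iff, Set.mem_singleton_iff] using hc
  have hZ : ∀ (i j : Fin g) (h : i ≠ j), (t i = false ∨ t j = true) → ∀ n : ℤ, moveZ i j h n ∈ R :=
    fun i j h hij n => SurfaceGroup.moveZ_mem_goeritz 𝒞 R hR
      (fun k l hkl => SurfaceGroup.exists_realises_moveZ_gt hkl) i j h (fun c hc => by
      rcases h𝒞 c hc with rfl | rfl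
      · exact Or.inl rfl
      · exact hij) n
  have hX : ∀ j, t j = false → ∀ n : ℤ, moveX j n ∈ R :=
    fun j hj n => SurfaceGroup.moveX_mem_goeritz 𝒞 R hR j (fun c hc => by
      rcases h𝒞 c hc with rfl | rfl
      · rfl
      · exact hj) n
  have hW : ∀ i j, i ≠ j → (t i = false ∨ t j = false) → ∀ n : ℤ, moveW i j n ∈ R :=
    fun i j h hij n => SurfaceGroup.moveW_mem_goeritz 𝒞 R hR
      (fun k l hkl => SurfaceGroup.exists_realises_moveZ_gt hkl) i j h (fun c hc => by
      rcases h𝒞 c hc with rfl | rfl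
      · exact Or.inl rfl
      · exact hij) n
  have hE := SurfaceGroup.signFlip_mem_goeritz 𝒞 R hR
  have hΘ := SurfaceGroup.orientationFlip_mem_goeritz 𝒞 R hR
    (SurfaceGroup.exists_realises_orientationFlip g)
  -- the cut swap of `c₀` and the conjugated automorphism `F' = J⁻¹ F J`
  obtain ⟨J, hJ, hκ⟩ := SurfaceGroup.exists_realises_cutSwapEquiv (g := g) c₀
  set F' : (surfaceGen g → ℤ) ≃ₗ[ℤ] (surfaceGen g → ℤ) := J⁻¹ * F * J with hF'def
  have hF' : ∀ v, F' v = J⁻¹ (F (J v)) := fun v => rfl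
  have hJinv : ∀ w, J (J⁻¹ w) = w := fun w => J.apply_symm_apply w
  have hS' : ∀ u v, symplForm (F' u) (F' v) = ε * symplForm u v := fun u v => by
    rw [hF', hF', ← symplForm_swapLin c₀ J hJ (J⁻¹ (F (J u))), hJinv, hJinv, hS,
      symplForm_swapLin c₀ J hJ]
  have hA' : ∀ v : surfaceGen g → ℤ, (∀ i, v (i, true) = 0) → ∀ i, F' v (i, true) = 0 := by
    intro v hv i
    have hu : ∀ j, J v (j, !c₀ j) = 0 := fun j => by
      rw [swapLin_apply_not c₀ J hJ, hv]; simp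
    have key := swapLin_apply_not c₀ J hJ (J⁻¹ (F (J v))) i
    rw [hJinv, h0 _ hu i] at key
    rw [hF']
    cases hc : c₀ i <;> rw [hc] at key
    · simpa using key.symm
    · simpa using key.symm
  have ht' : ∀ v : surfaceGen g → ℤ, (∀ i, v (i, !t i) = 0) → ∀ i, F' v (i, !t i) = 0 := by
    intro v hv i
    have hu : ∀ j, J v (j, !c₁ j) = 0 := fun j => by
      rw [swapLin_apply_not_or c₀ c₁ h01 J hJ, hv]
    have key := swapLin_apply_not_or c₀ c₁ h01 J hJ (J⁻¹ (F (J v))) i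
    rw [hJinv, h1 _ hu i] at key
    rw [hF']
    exact key.symm
  -- realise `F'` in the Goeritz group of `(⊥, t)` and conjugate back
  have hmem := mem_of_pairStabilizer_signed t R hZ hX hW hE hΘ
    (fun A hA R' hRA hZ' hX' hW' G hG hG0 hG1 =>
      mem_of_blocks_eq_one t A hA R' hRA hZ' hX' hW' _ G hG hG0 hG1 le_rfl) F' ε hε hS' hA' ht'
  obtain ⟨x', hx', hx'F⟩ := (hR F').1 hmem
  have hbot : (SurfaceGroup.cutKernel fun _ : Fin g => false).map (SurfaceGroup.cutSwapEquiv c₀).toMonoidHom = SurfaceGroup.cutKernel c₀ := by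
    rw [SurfaceGroup.map_cutKernel_cutSwapEquiv]
    congr 1
    funext i
    cases c₀ i <;> rfl
  have htop : (SurfaceGroup.cutKernel t).map (SurfaceGroup.cutSwapEquiv c₀).toMonoidHom = SurfaceGroup.cutKernel c₁ := by
    rw [SurfaceGroup.map_cutKernel_cutSwapEquiv]
    congr 1
    funext i
    cases hc : c₀ i
    · simp [ht, hc]
    · simp [ht, hc, h01 i hc]
  have hmem0 : (fun _ : Fin g => false) ∈ 𝒞 := by simp [h𝒞def]
  have hmemt : t ∈ 𝒞 := by simp [h𝒞def]
  refine ⟨((SurfaceGroup.cutSwapEquiv c₀).symm.trans x').trans (SurfaceGroup.cutSwapEquiv c₀),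
    ?_, ?_, fun s => ?_⟩
  · rw [SurfaceGroup.map_trans_toMonoidHom, SurfaceGroup.map_trans_toMonoidHom,
      SurfaceGroup.map_symm_toMonoidHom_of_eq _ hbot,
      hx' _ hmem0, hbot]
  · rw [SurfaceGroup.map_trans_toMonoidHom, SurfaceGroup.map_trans_toMonoidHom,
      SurfaceGroup.map_symm_toMonoidHom_of_eq _ htop,
      hx' _ hmemt, htop]
  · rw [realises_mul hκ (realises_mul hx'F (realises_inv hκ)) s, hF'def]
    congr 1
    rw [show J * (J⁻¹ * F * J * J⁻¹) = F by group]

end Realisation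

/-! ## §2 The standard kernels and Lagrangians are coordinate -/

/-- The coordinate cut system `s4CutSystem m i` is the graph of `j ↦ (j + i ≡ 2 mod 3)`. -/
theorem s4CutSystem_eq_range (m : ℕ) (i : Fin 3) :
    s4CutSystem m i = Set.range fun j : Fin (3 + 3 * m) =>
      (j, decide (((j : ℕ) + (i : ℕ)) % 3 = 2)) := by
  ext ⟨j, s⟩
  simp only [s4CutSystem, Set.mem_setOf_eq, Set.mem_range, Prod.mk.injEq]
  rw [mem_s4Gens_iff_eq]
  simp only [Nat.mod_add_mod]
  constructor
  · rintro rfl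
    exact ⟨j, rfl, rfl⟩
  · rintro ⟨j', rfl, rfl⟩
    rfl

/-- **The standard kernels are cut kernels**: `s4Kernels.stabilizeIter m i` is the cut kernel of
`j ↦ (j + i ≡ 2 mod 3)` (cut normal form `stub_cutNormalForm`). -/
theorem stabilizeIter_eq_cutKernel (m : ℕ) (i : Fin 3) :
    s4Kernels.stabilizeIter m i =
      SurfaceGroup.cutKernel (fun j : Fin (3 + 3 * m) => decide (((j : ℕ) + (i : ℕ)) % 3 = 2)) := by
  rw [NilpotentShadowsStandard.SaturatedTorsorDescent.stub_cutNormalForm m i, s4CutSystem_eq_range,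
    ← Set.range_comp]
  rfl

/-- The coordinate Lagrangian of slot `i` is the span of the `δ_{(j, (j + i ≡ 2 mod 3))}`. -/
theorem span_single_s4CutSystem (m : ℕ) (i : Fin 3) :
    Submodule.span ℤ ((fun y => (Pi.single y (1 : ℤ) : surfaceGen (3 + 3 * m) → ℤ)) ''
        s4CutSystem m i) =
      Submodule.span ℤ (Set.range fun j : Fin (3 + 3 * m) =>
        (Pi.single (j, decide (((j : ℕ) + (i : ℕ)) % 3 = 2)) (1 : ℤ) : surfaceGen (3 + 3 * m) → ℤ)) := by
  rw [s4CutSystem_eq_range, ← Set.range_comp]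
  rfl

/-- From `Λ_c.map F = Λ_c` to coordinates: `F` preserves the condition `v_{(j, ¬c j)} = 0`. -/
theorem coords_of_map_span_eq {n : ℕ} (c : Fin n → Bool) (F : (surfaceGen n → ℤ) ≃ₗ[ℤ] (surfaceGen n → ℤ))
    (h : (Submodule.span ℤ (Set.range fun j : Fin n =>
        (Pi.single (j, c j) (1 : ℤ) : surfaceGen n → ℤ))).map F.toLinearMap =
      Submodule.span ℤ (Set.range fun j : Fin n => (Pi.single (j, c j) (1 : ℤ) : surfaceGen n → ℤ))) :
    ∀ v : surfaceGen n → ℤ, (∀ j, v (j, !c j) = 0) → ∀ j, F v (j, !c j) = 0 := by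
  intro v hv
  rw [← mem_span_range_single_iff]
  rw [← h]
  exact Submodule.mem_map_of_mem ((mem_span_range_single_iff c v).2 hv)

/-! ## §3 The stub -/

/-- **Stub `stub_goeritzRealisationPos` (GS₀ at genus `3+3m`).**  Given (and here not using) the
genus-`3` realisation, for every `m ≥ 1` every `ε`-isometry `F` (`ε = ±1`) of `H₁ = ℤ^{2(3+3m)}`
stabilising the coordinate Lagrangians of slots `0` and `1` of the standard trisection of `S⁴` is
induced by an automorphism of `SurfaceGroup (3+3m)` stabilising `N 0` and `N 1`
(`N = s4Kernels.stabilizeIter m`).  From `exists_goeritz_realises` (the Goeritz group of a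
coordinate Heegaard diagram maps onto the stabiliser of its two Lagrangians in `Sp^{±}(2g, ℤ)`,
Zieschang–Vogt–Coldewey §3.6), the cut normal form of the standard kernels and the coordinate
description of their abelian shadows. [folklore] -/
theorem stub_goeritzRealisationPos :
    (∀ (F : (surfaceGen (3 + 3 * 0) → ℤ) ≃ₗ[ℤ] (surfaceGen (3 + 3 * 0) → ℤ)) (ε : ℤ), (ε = 1 ∨ ε = -1) →
      (∀ u v : surfaceGen (3 + 3 * 0) → ℤ, symplForm (F u) (F v) = ε * symplForm u v) →
      (Submodule.span ℤ ((fun y => (Pi.single y (1 : ℤ) : surfaceGen (3 + 3 * 0) → ℤ)) ''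
          s4CutSystem 0 0)).map F.toLinearMap =
        Submodule.span ℤ ((fun y => (Pi.single y (1 : ℤ) : surfaceGen (3 + 3 * 0) → ℤ)) ''
          s4CutSystem 0 0) →
      (Submodule.span ℤ ((fun y => (Pi.single y (1 : ℤ) : surfaceGen (3 + 3 * 0) → ℤ)) ''
          s4CutSystem 0 1)).map F.toLinearMap =
        Submodule.span ℤ ((fun y => (Pi.single y (1 : ℤ) : surfaceGen (3 + 3 * 0) → ℤ)) ''
          s4CutSystem 0 1) →
      ∃ x : SurfaceGroup (3 + 3 * 0) ≃* SurfaceGroup (3 + 3 * 0),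
        (s4Kernels.stabilizeIter 0 0).map x.toMonoidHom = s4Kernels.stabilizeIter 0 0 ∧
        (s4Kernels.stabilizeIter 0 1).map x.toMonoidHom = s4Kernels.stabilizeIter 0 1 ∧
        ∀ s : SurfaceGroup (3 + 3 * 0),
          toAdd (SurfaceGroup.abelianize (3 + 3 * 0) (x s)) =
            F (toAdd (SurfaceGroup.abelianize (3 + 3 * 0) s))) →
    ∀ (m : ℕ), 0 < m →
    ∀ (F : (surfaceGen (3 + 3 * m) → ℤ) ≃ₗ[ℤ] (surfaceGen (3 + 3 * m) → ℤ)) (ε : ℤ), (ε = 1 ∨ ε = -1) →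
      (∀ u v : surfaceGen (3 + 3 * m) → ℤ, symplForm (F u) (F v) = ε * symplForm u v) →
      (Submodule.span ℤ ((fun y => (Pi.single y (1 : ℤ) : surfaceGen (3 + 3 * m) → ℤ)) ''
          s4CutSystem m 0)).map F.toLinearMap =
        Submodule.span ℤ ((fun y => (Pi.single y (1 : ℤ) : surfaceGen (3 + 3 * m) → ℤ)) ''
          s4CutSystem m 0) →
      (Submodule.span ℤ ((fun y => (Pi.single y (1 : ℤ) : surfaceGen (3 + 3 * m) → ℤ)) ''
          s4CutSystem m 1)).map F.toLinearMap =
        Submodule.span ℤ ((fun y => (Pi.single y (1 : ℤ) : surfaceGen (3 + 3 * m) → ℤ)) ''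
          s4CutSystem m 1) →
      ∃ x : SurfaceGroup (3 + 3 * m) ≃* SurfaceGroup (3 + 3 * m),
        (s4Kernels.stabilizeIter m 0).map x.toMonoidHom = s4Kernels.stabilizeIter m 0 ∧
        (s4Kernels.stabilizeIter m 1).map x.toMonoidHom = s4Kernels.stabilizeIter m 1 ∧
        ∀ s : SurfaceGroup (3 + 3 * m),
          toAdd (SurfaceGroup.abelianize (3 + 3 * m) (x s)) =
            F (toAdd (SurfaceGroup.abelianize (3 + 3 * m) s)) := by

  intro _ m _ F ε hε hS hΛ0 hΛ1
  rw [span_single_s4CutSystem] at hΛ0 hΛ1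
  have h01 : ∀ j : Fin (3 + 3 * m), decide (((j : ℕ) + ((0 : Fin 3) : ℕ)) % 3 = 2) = true →
      decide (((j : ℕ) + ((1 : Fin 3) : ℕ)) % 3 = 2) = false := by
    intro j
    simp only [Fin.val_zero, Fin.val_one, decide_eq_true_eq, decide_eq_false_iff_not]
    omega
  obtain ⟨x, hx0, hx1, hxF⟩ := exists_goeritz_realises _ _ h01 F ε hε hS
    (coords_of_map_span_eq _ F hΛ0) (coords_of_map_span_eq _ F hΛ1)
  refine ⟨x, ?_, ?_, hxF⟩
  · rw [stabilizeIter_eq_cutKernel]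
    exact hx0
  · rw [stabilizeIter_eq_cutKernel]
    exact hx1

end Summit.SmoothPoincare4.SmoothPoincare4.Theorems.ShadowApproximation.NilpotentGenusClass

end
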